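import Summits.HodgeConjecture.HodgeConjecture.Theses.SevenfoldWeilCensus
import Summits.HodgeConjecture.HodgeConjecture.Theses.TropicalCuspLift
import Summits.HodgeConjecture.HodgeConjecture.Theses.NodalThetaWeil
import Literature.AlgebraicGeometry.HodgeTheory.WeilClassesSixfolds
import Literature.AlgebraicGeometry.Motives.HyperbolicWeilType
import Literature.AlgebraicGeometry.Motives.FamiliesVHS
import Literature.AlgebraicGeometry.HodgeTheory.IsoTransport

/-!
# Birth skeleton (BC3) for the crux `WeilSixfolds` — route `SevenfoldWeilCensus`

Crux item `stmt-HodgeConjecture-2524`, decl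
`Summit.HodgeConjecture.HodgeConjecture.Theses.SevenfoldWeilCensus.WeilSixfolds`
(rank-4 crux of `route-HodgeConjecture-SevenfoldWeilCensus`; the same normalised statement — textually
identical bodies — is the item's primary copy `Theses.TropicalCuspLift.WeilSixfolds` (route retired
2026-08-16) and the `target` `Theses.NodalThetaWeil.WeilSixfolds`; the composition below concludes ALL
THREE copies by name, the sibling copies by definitional unfolding):

  for every `d > 0`, every abelian sixfold `A/ℂ` with `φ ∈ End A`, `φ ∘ φ = -d`, every rational
  `(3,3)`-class lying in the Weil plane `E₊ ⊔ E₋` (inline eigen-pair form: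
  `(x + yφ)^* cⱼ = (x ± y i √d)⁶ • cⱼ`) is algebraic (`∈ algebraicClasses A.X 3`).

## Idea — discriminant dichotomy + anchored transport on the anisotropic components

* `stub_hyperbolicSixfolds` : the HYPERBOLIC components (discriminant class `-1 ∈ ℚ*/Nm K*`,
  i.e. some `K`-symmetrised hyperplane class `d•h + φ^*h` has an isotropic rational `3`-plane) —
  exactly Markman's theorem [Markman2025SecantWeil, Thm 1.5.1], invoked BY NAME as the tree fact
  `Literature.AlgebraicGeometry.HodgeTheory.Markman2025_weilClasses_algebraic_hyperbolicSixfold`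
  (theorem in print; XL formalisation).
* `stub_anisotropicSixfoldAnchors` : through every NON-hyperbolic Weil sixfold `(A, φ)` and every
  Weil class `c` on it passes a smooth projective family of `ℚ(√-d)`-Weil sixfolds over a smooth
  irreducible base, carrying a GLOBAL class `W` on the total space with `W|_{s₁} = c` under
  `A ≅ 𝒳_{s₁}`, fibrewise rational of type `(3,3)`, and ALGEBRAIC at some anchor fibre `s₀`.
  Intended witnesses: Deligne's Weil family over the Shimura component through `(A, φ, L)`
  [Deligne1982HodgeCycles §§4–5; vanGeemen1994HodgeAV, 5.2 and 5.4], the global-class rendering via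
  the theorem of the fixed part, anchored at the product / CM points `A′ × B`, `E³ × Ē³` of that
  component, where the Weil classes are algebraic by [Markman2025SecantWeil, Thm 1.1] ⊗ Lefschetz
  `(1,1)` + Schoen's product theorem + isogeny invariance (tree:
  `Markman2025_weilClasses_algebraic_abelianFourfold`,
  `Schoen1998_weilClasses_algebraic_of_prod_surface_all_holds`,
  `weilClassesOf_le_algebraicClasses_of_isogenyPair`).  Plausibly a theorem in print modulo
  assembly; XL.
* `stub_weilSixfoldFamiliesVHC` : the variational Hodge conjecture for `(3,3)`-classes along smooth
  projective families all of whose fibres are `ℚ(√-d)`-Weil sixfolds — algebraic at one fibre ⇒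
  algebraic at every fibre.  THIS IS THE OPEN ENGINE (hardest stub).  Known mechanism: semiregular /
  unobstructed representatives (Bloch 1972; [BuchweitzFlenner2003, Thm 5.2] = tree fact
  `BlochSemiregularSpread`; [CharlesSchnell2014Notes, Conj. 11.3.1]); Markman's secant sheaves
  realise it only on the hyperbolic lattice [Markman2025SecantWeil §1.5; arXiv:2603.20268, p. 3].
  A crux-plan line refines THIS stub (semiregular-anchor supply on the anisotropic components).

Composition `WeilSixfolds_of`: the inline eigen-pair hypothesis is `c ∈ weilClassesOf A φ 3 d`
(`mem_weilClassesOf_iff`); case on hyperbolicity of some `K`-symmetrised hyperplane class: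
hyperbolic ⇒ stub 1; otherwise stub 2 gives the anchored family, stub 3 transports algebraicity from
`s₀` to `s₁`, and `mem_algebraicClasses_map_iff_of_iso` moves it across `A ≅ 𝒳_{s₁}`.

## Dead lines avoided (evidence on the shared item / the sibling crux `WeilSixfoldsSqrtMinus7`)

* depth-1 cusp lift / `WittTowerStep` (`TropicalCuspLift`, route CLOSED 2026-08-16: `DepthOneLogLift`
  refuted on paper, K-balance / Künneth obstruction) — no degeneration to the boundary is used here;
* the bare 2-stub Markman split (`weilSixfolds_of_markmanSplit_of_nonHyperbolic`, registered for
  stmt-HodgeConjecture-1260 and declared line-dead: residual stub = the open problem verbatim, no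
  engine) — kept only as the case split INSIDE the composition; the anisotropic half is cut further
  into anchors (stub 2, in print) and transport (stub 3, the engine);
* hyperbolic-eightfold descent
  (`Cruxes/WeilSixfoldsSqrtMinus7/Lines/hyperbolic-eightfold-descent-dead.md`: nothing is known in
  dimension ≥ 8, Markman's secant variety is a proper subvariety for `n ≥ 4`) — not used;
* the refuted E-line connectivity statement (negatives index, stmt-HodgeConjecture-12555, K3 lattice
  transport) — unrelated: stub 3 transports along families of WEIL-TYPE SIXFOLDS carrying a global
  class.

Disproof used: none — `ledger crux ls stmt-HodgeConjecture-2524` shows no `Disproof.lean` on this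
crux (2026-08-17); negatives index (3 entries: Milnor-K symbol lift, Fermat-K3 exhaustion, E-line
connectivity) contains no statement equal or trivially equivalent to a stub.

Mode: skeleton-register (BC3 birth certificate), `planner-skel-stmt-HodgeConjecture-2524-0`,
2026-08-17.
-/

set_option linter.dupNamespace false

namespace Summit.HodgeConjecture.HodgeConjecture.Cruxes.WeilSixfolds.Birth

open CategoryTheory
open Literature.AlgebraicGeometry.Motives Literature.AlgebraicGeometry.HodgeTheory
open Summit.HodgeConjecture.HodgeConjecture.Theses.SevenfoldWeilCensus

/-! ## Stub statements -/

/-- Stub 1 statement — the hyperbolic (discriminant `-1`) Weil sixfolds: Markman's theorem, by name.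
[cite: Markman2025SecantWeil, Thm 1.5.1] -/
def HyperbolicSixfolds : Prop :=
  Markman2025_weilClasses_algebraic_hyperbolicSixfold

/-- Stub 2 statement — ANCHORED WEIL FAMILIES through every non-hyperbolic Weil sixfold: for
`d > 0`, `(A, φ)` a sixfold with `φ² = -d` such that NO `K`-symmetrised hyperplane class
`d•h + φ^*h` is of hyperbolic Weil type, and `c` a rational `(3,3)` Weil class, there are a smooth
projective family `f : 𝒳 → S` of relative dimension `6` over a smooth irreducible base, points
`s₁ s₀ ∈ S(ℂ)`, an iso `e : A ≅ 𝒳_{s₁}` and a global class `W ∈ H⁶(𝒳(ℂ); ℂ)` with: every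
`W|_{𝒳_s}` rational of type `(3,3)`; every fibre a `ℚ(√-d)`-Weil sixfold; `e^*(W|_{s₁}) = c`; and
`W|_{s₀}` algebraic.  (Deligne's Weil family + theorem of the fixed part, anchored at product / CM
points.) [cite: Deligne1982HodgeCycles; vanGeemen1994HodgeAV, 5.2, 5.4; Markman2025SecantWeil, Thm 1.1;
Schoen1998Addendum] -/
def AnisotropicSixfoldAnchors : Prop :=
  ∀ (d : ℕ), 0 < d → ∀ (A : AbelianVariety ℂ) (φ : A ⟶ A), A.dim = 2 * 3 →
    IsSmoothProjective (2 * 3) A.X → φ ≫ φ = -(d • 𝟙 A) →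
    (∀ (e : ProjectiveEmbedding A.X) (a : complexBetti (projectiveSpace e.n ℂ) 2),
        IsRationalClass a → a ≠ 0 →
          ¬ IsHyperbolicWeilType A φ 3
              ((d : ℂ) • complexBetti.map e.ι 2 a +
                complexBetti.map φ.hom.hom.hom 2 (complexBetti.map e.ι 2 a))) →
    ∀ c : complexBetti A.X (2 * 3), IsRationalClass c → IsOfHodgeType (2 * 3) A.X (2 * 3) 3 3 c →
      c ∈ weilClassesOf A φ 3 d →
      ∃ (𝒳 S : SchemeOver ℂ) (f : 𝒳 ⟶ S) (s₁ s₀ : ComplexPoints S) (e : A.X ≅ fiberOver f s₁)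
        (W : complexBetti 𝒳 (2 * 3)),
        IsSmoothProjectiveFamily f (2 * 3) ∧ IrreducibleSpace S.left ∧ AlgebraicGeometry.Smooth S.hom ∧
        (∀ s : ComplexPoints S, IsRationalClass (complexBetti.map (fiberι f s) (2 * 3) W) ∧
          IsOfHodgeType (2 * 3) (fiberOver f s) (2 * 3) 3 3 (complexBetti.map (fiberι f s) (2 * 3) W)) ∧
        (∀ s : ComplexPoints S, ∃ (A' : AbelianVariety ℂ) (φ' : A' ⟶ A'),
          A'.dim = 2 * 3 ∧ φ' ≫ φ' = -(d • 𝟙 A') ∧ Nonempty (A'.X ≅ fiberOver f s)) ∧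
        complexBetti.map e.hom (2 * 3) (complexBetti.map (fiberι f s₁) (2 * 3) W) = c ∧
        complexBetti.map (fiberι f s₀) (2 * 3) W ∈ algebraicClasses (fiberOver f s₀) 3

/-- Stub 3 statement — VARIATIONAL HODGE FOR `(3,3)`-CLASSES ALONG WEIL-SIXFOLD FAMILIES: for
`d > 0` and a smooth projective family `f : 𝒳 → S` of relative dimension `6` over a smooth
irreducible base all of whose fibres are `ℚ(√-d)`-Weil sixfolds, a global class
`W ∈ H⁶(𝒳(ℂ); ℂ)` with every restriction `W|_{𝒳_s}` rational of type `(3,3)` and algebraic at ONE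
fibre is algebraic at EVERY fibre.  The open engine of the line (Grothendieck's variational Hodge
conjecture in this sector; known only via semiregular representatives).
[cite: BuchweitzFlenner2003, Thm 5.2; CharlesSchnell2014Notes, Conj. 11.3.1; Markman2025SecantWeil, §1.5] -/
def WeilSixfoldFamiliesVHC : Prop :=
  ∀ (d : ℕ), 0 < d → ∀ ⦃𝒳 S : SchemeOver ℂ⦄ (f : 𝒳 ⟶ S), IsSmoothProjectiveFamily f (2 * 3) →
    IrreducibleSpace S.left → AlgebraicGeometry.Smooth S.hom →
    ∀ (W : complexBetti 𝒳 (2 * 3)),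
      (∀ s : ComplexPoints S, IsRationalClass (complexBetti.map (fiberι f s) (2 * 3) W) ∧
        IsOfHodgeType (2 * 3) (fiberOver f s) (2 * 3) 3 3 (complexBetti.map (fiberι f s) (2 * 3) W)) →
      (∀ s : ComplexPoints S, ∃ (A' : AbelianVariety ℂ) (φ' : A' ⟶ A'),
        A'.dim = 2 * 3 ∧ φ' ≫ φ' = -(d • 𝟙 A') ∧ Nonempty (A'.X ≅ fiberOver f s)) →
      (∃ s₀ : ComplexPoints S,
        complexBetti.map (fiberι f s₀) (2 * 3) W ∈ algebraicClasses (fiberOver f s₀) 3) →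
      ∀ s : ComplexPoints S, complexBetti.map (fiberι f s) (2 * 3) W ∈ algebraicClasses (fiberOver f s) 3

/-! ## Registered stubs (the ONLY sorries of the file) -/

/-- STUB 1 (known, XL): Markman's theorem for hyperbolic Weil sixfolds.
[cite: Markman2025SecantWeil, Thm 1.5.1] -/
theorem stub_hyperbolicSixfolds : HyperbolicSixfolds := by
  sorry

/-- STUB 2 (in print modulo assembly, XL): anchored Weil families through every non-hyperbolic Weil
sixfold. [cite: Deligne1982HodgeCycles; vanGeemen1994HodgeAV, 5.2, 5.4; Markman2025SecantWeil, Thm 1.1] -/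
theorem stub_anisotropicSixfoldAnchors : AnisotropicSixfoldAnchors := by
  sorry

/-- STUB 3 (OPEN — the engine, hardest): variational Hodge for `(3,3)`-classes along families of
Weil-type sixfolds. [cite: BuchweitzFlenner2003, Thm 5.2; CharlesSchnell2014Notes, Conj. 11.3.1] -/
theorem stub_weilSixfoldFamiliesVHC : WeilSixfoldFamiliesVHC := by
  sorry

namespace __Registered

/-- Registered signature of `stub_hyperbolicSixfolds`. -/
abbrev stub_hyperbolicSixfolds : Prop := HyperbolicSixfolds
/-- Registered signature of `stub_anisotropicSixfoldAnchors`. -/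
abbrev stub_anisotropicSixfoldAnchors : Prop := AnisotropicSixfoldAnchors
/-- Registered signature of `stub_weilSixfoldFamiliesVHC`. -/
abbrev stub_weilSixfoldFamiliesVHC : Prop := WeilSixfoldFamiliesVHC

end __Registered

/-! ## Composition (real proof, no sorry) -/

/-- THE COMPOSITION: the three stubs imply the crux `SevenfoldWeilCensus.WeilSixfolds` BY NAME
(the copy of the payload route `route-HodgeConjecture-SevenfoldWeilCensus`).  Hyperbolic components
by stub 1; on the anisotropic components, stub 2 supplies an anchored Weil family through `(A, c)`
and stub 3 transports algebraicity from the anchor fibre to the fibre `≅ A`; the iso-transport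
lemma `mem_algebraicClasses_map_iff_of_iso` finishes. [folklore] -/
theorem WeilSixfolds_of :
    __Registered.stub_hyperbolicSixfolds → __Registered.stub_anisotropicSixfoldAnchors →
      __Registered.stub_weilSixfoldFamiliesVHC →
        Summit.HodgeConjecture.HodgeConjecture.Theses.SevenfoldWeilCensus.WeilSixfolds := by
  intro hM hAn hV d hd A φ hA hX hφ c hc h33 hsplit
  -- the inline eigen-pair hypothesis of the crux is membership in the Weil plane `E₊ ⊔ E₋`
  have hcW : c ∈ weilClassesOf A φ 3 d := mem_weilClassesOf_iff.mpr hsplit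
  by_cases hhyp : ∃ (e : ProjectiveEmbedding A.X) (a : complexBetti (projectiveSpace e.n ℂ) 2),
      IsRationalClass a ∧ a ≠ 0 ∧
        IsHyperbolicWeilType A φ 3
          ((d : ℂ) • complexBetti.map e.ι 2 a +
            complexBetti.map φ.hom.hom.hom 2 (complexBetti.map e.ι 2 a))
  · -- hyperbolic (discriminant `-1`) for some `K`-symmetrised hyperplane class: Markman's theorem
    obtain ⟨e, a, ha, ha0, hh⟩ := hhyp
    exact hM d hd A φ hA hX hφ e a ha ha0 hh c hc h33 hcW
  · -- anisotropic components: anchored Weil family through `A`, then transport along it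
    obtain ⟨𝒳, S, f, s₁, s₀, e, W, hf, hirr, hsm, hW, hab, hWc, h₀⟩ :=
      hAn d hd A φ hA hX hφ (fun e a ha ha0 hh => hhyp ⟨e, a, ha, ha0, hh⟩) c hc h33 hcW
    have h₁ := hV d hd f hf hirr hsm W hW hab ⟨s₀, h₀⟩ s₁
    rw [← hWc]
    exact (mem_algebraicClasses_map_iff_of_iso e).2 h₁

/-- The same composition concluding the item's PRIMARY copy `TropicalCuspLift.WeilSixfolds`
(stmt-HodgeConjecture-2524 was first filed there; the bodies are textually identical, so this is
`WeilSixfolds_of` up to definitional unfolding). [folklore] -/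
theorem WeilSixfolds_of_primary :
    __Registered.stub_hyperbolicSixfolds → __Registered.stub_anisotropicSixfoldAnchors →
      __Registered.stub_weilSixfoldFamiliesVHC →
        Summit.HodgeConjecture.HodgeConjecture.Theses.TropicalCuspLift.WeilSixfolds :=
  fun hM hAn hV d hd A φ hA hX hφ c hc h33 hsplit =>
    WeilSixfolds_of hM hAn hV d hd A φ hA hX hφ c hc h33 hsplit

/-- The same composition concluding the `NodalThetaWeil` copy (its `target` item). [folklore] -/
theorem WeilSixfolds_of_nodalThetaWeil :
    __Registered.stub_hyperbolicSixfolds → __Registered.stub_anisotropicSixfoldAnchors →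
      __Registered.stub_weilSixfoldFamiliesVHC →
        Summit.HodgeConjecture.HodgeConjecture.Theses.NodalThetaWeil.WeilSixfolds :=
  fun hM hAn hV d hd A φ hA hX hφ c hc h33 hsplit =>
    WeilSixfolds_of hM hAn hV d hd A φ hA hX hφ c hc h33 hsplit

/-- The crux (payload-route copy) from the registered stubs — sorry-tainted exactly through the
three `stub_*`. -/
theorem WeilSixfolds_of_stubs :
    Summit.HodgeConjecture.HodgeConjecture.Theses.SevenfoldWeilCensus.WeilSixfolds :=
  WeilSixfolds_of stub_hyperbolicSixfolds stub_anisotropicSixfoldAnchors stub_weilSixfoldFamiliesVHC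

/-- The crux (item's primary copy, the decl the skeleton registry keys on) from the registered
stubs — sorry-tainted exactly through the three `stub_*`. -/
theorem WeilSixfolds_proof :
    Summit.HodgeConjecture.HodgeConjecture.Theses.TropicalCuspLift.WeilSixfolds :=
  WeilSixfolds_of_primary stub_hyperbolicSixfolds stub_anisotropicSixfoldAnchors
    stub_weilSixfoldFamiliesVHC

/-- The crux (`NodalThetaWeil` copy) from the registered stubs. -/
theorem WeilSixfolds_proof_nodalThetaWeil :
    Summit.HodgeConjecture.HodgeConjecture.Theses.NodalThetaWeil.WeilSixfolds :=
  WeilSixfolds_of_nodalThetaWeil stub_hyperbolicSixfolds stub_anisotropicSixfoldAnchors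
    stub_weilSixfoldFamiliesVHC

end Summit.HodgeConjecture.HodgeConjecture.Cruxes.WeilSixfolds.Birth
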